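import Summits.CriticalPhenomena.SAWScalingLimit.Theorems.SAWDefectDecoherenceBoundaryClosureRLocalL1StarInversion
import Literature.Analysis.Complex.CauchyPompeiu
import Mathlib.Analysis.Calculus.ContDiff.RCLike

/-!
# Pick engine, STAGE 1 (S2) helper: the per-edge Taylor identity on the honeycomb lattice

Support file for crux `BoundaryClosureR` (stmt-CriticalPhenomena-14004), line `pick-half-plane`,
stub `stub_pickEngine`, step (S2) (weak `∂̄`-closure of the limit of the normalised functionals).
After the weighted star regrouping (`…PickEngineStarRegrouping`), the contribution of an
interior edge `e = {v, w}` oriented from the UP face `v` to the down face `w`, with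
`u = c_w - c_v ∈ {a, b, c}` and midpoint `m = (c_v + c_w)/2`, weighted by a test function
evaluated at the scaled centres, is

  `(φ(δc_v) - φ(δc_w)) · (m - c_v) F(e)
     = -(δ/2) F(e) [3a³ · conj u · ∂φ(δm) + (1/3) ∂̄φ(δm)] - (u/2) F(e) R`,   `|R| ≤ C_φ δ²`

(`edge_taylor_identity`): Taylor to first order at `δm` with the Wirtinger decomposition
`Dφ(z)[u] = ∂φ(z) u + ∂̄φ(z) conj u` (`fderiv_apply_eq_wirtinger`; `∂̄ = dbarAlong 1` of the
tree), the symmetric second-order remainder bound for `C²` functions with compact support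
(`norm_symm_diff_sub_fderiv_le`), and the KEY LATTICE FACT `u² = 3a³ · conj u` for the three
up-to-down vectors, which holds because `a³ = b³ = c³ (= (2ζ-1)/9 = i/(3√3))`
(`vecA_cube`, `vecB_cube`, `vecC_cube`, `sq_eq_of_mem_nbrs_up`) and `|u|² = 1/3`.
So the `∂φ`-terms assemble into the CONJUGATE-CLASS sum of the route's `ConjugateClassNegligible`
(test function `∂φ`) and the `∂̄φ`-terms into the normalised functional applied to `∂̄φ`.
References: Duminil-Copin–Smirnov (2012) §3; Hörmander, *SCV* §1.1 (Wirtinger derivatives).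
-/

noncomputable section

open scoped BigOperators ComplexConjugate
open Finset Set Metric Complex
open Literature.Probability.LatticeModels Literature.Probability.RandomPlanarGeometry
open Literature.Probability.RandomPlanarGeometry.SAW
open Literature.Barriers.CriticalPhenomena Literature.Barriers.CriticalPhenomena.HexGreen
open Literature.Barriers.CriticalPhenomena.HexKernel (vecA vecB vecC unitE0 unitE1 term)
open Literature.Analysis.Complex (dbarAlong dbarAlong_one)
open Summit.CriticalPhenomena.SAWScalingLimit.Theorems.PickHalfPlane.LocalL1

namespace Summit.CriticalPhenomena.SAWScalingLimit.Theorems.PickHalfPlane.Engine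

/-! ### Wirtinger decomposition and the symmetric Taylor remainder -/

/-- **Wirtinger decomposition of the real derivative**: for `φ : ℂ → ℂ`,
`Dφ(z)[u] = ∂φ(z)·u + ∂̄φ(z)·conj u` with `∂φ = ½(φₓ - iφ_y)`, `∂̄φ = ½(φₓ + iφ_y)`
(`∂̄ = dbarAlong 1`; Hörmander, *SCV* §1.1). [folklore] -/
theorem fderiv_apply_eq_wirtinger (φ : ℂ → ℂ) (z u : ℂ) :
    fderiv ℝ φ z u = (2 : ℂ)⁻¹ * (fderiv ℝ φ z 1 - I * fderiv ℝ φ z I) * u +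
      dbarAlong 1 φ z * conj u := by
  obtain ⟨a, b, rfl⟩ : ∃ a b : ℝ, u = (a : ℂ) + (b : ℂ) * I :=
    ⟨u.re, u.im, (Complex.re_add_im u).symm⟩
  have hsplit : (a : ℂ) + (b : ℂ) * I = (a : ℝ) • (1 : ℂ) + (b : ℝ) • I := by
    rw [Complex.real_smul, Complex.real_smul, mul_one]
  have hL : fderiv ℝ φ z ((a : ℂ) + (b : ℂ) * I) =
      (a : ℂ) * fderiv ℝ φ z 1 + (b : ℂ) * fderiv ℝ φ z I := by
    rw [hsplit, map_add, (fderiv ℝ φ z).map_smul, (fderiv ℝ φ z).map_smul, Complex.real_smul,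
      Complex.real_smul]
  have hconj : conj ((a : ℂ) + (b : ℂ) * I) = (a : ℂ) - (b : ℂ) * I := by
    simp only [map_add, map_mul, Complex.conj_ofReal, Complex.conj_I]; ring
  rw [hL, hconj, dbarAlong_one, smul_eq_mul]
  linear_combination ((b : ℂ) * fderiv ℝ φ z I) * Complex.I_mul_I

/-- **Symmetric second-order Taylor remainder.** For `φ ∈ C²(ℂ)` with compact support there is
`C` with `‖φ(m + h) - φ(m - h) - Dφ(m)[2h]‖ ≤ C ‖h‖²` for all `m, h` (mean value inequality
along `t ↦ φ(m + t h) - t·Dφ(m)[h]`, `t ∈ [-1, 1]`, the derivative `Dφ(m + th)[h] - Dφ(m)[h]`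
being bounded by `L |t| ‖h‖²` for a Lipschitz constant `L` of `Dφ`). [folklore] -/
theorem norm_symm_diff_sub_fderiv_le {φ : ℂ → ℂ} (hφ : ContDiff ℝ 2 φ)
    (hφc : HasCompactSupport φ) :
    ∃ C : ℝ, 0 ≤ C ∧ ∀ m h : ℂ, ‖φ (m + h) - φ (m - h) - fderiv ℝ φ m ((2 : ℝ) • h)‖ ≤ C * ‖h‖ ^ 2 := by
  -- `Dφ` is `C¹` with compact support, hence Lipschitz
  have hD : ContDiff ℝ 1 (fderiv ℝ φ) := hφ.fderiv_right (by norm_num)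
  obtain ⟨L, hL⟩ := hD.lipschitzWith_of_hasCompactSupport (hφc.fderiv ℝ) (by norm_num)
  refine ⟨2 * L, by positivity, fun m h => ?_⟩
  have hdiff : Differentiable ℝ φ := hφ.differentiable (by norm_num)
  -- the auxiliary one-variable function
  set G : ℝ → ℂ := fun t => φ (m + (t : ℂ) * h) - (t : ℂ) * fderiv ℝ φ m h with hG
  have hGd : ∀ t : ℝ, HasDerivAt G (fderiv ℝ φ (m + (t : ℂ) * h) h - fderiv ℝ φ m h) t := by
    intro t
    have h1 : HasDerivAt (fun t : ℝ => m + (t : ℂ) * h) h t := by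
      simpa using ((Complex.ofRealCLM.hasDerivAt (x := t)).mul_const h).const_add m
    have h2 : HasDerivAt (fun t : ℝ => φ (m + (t : ℂ) * h)) (fderiv ℝ φ (m + (t : ℂ) * h) h) t :=
      (hdiff (m + (t : ℂ) * h)).hasFDerivAt.comp_hasDerivAt t h1
    have h3 : HasDerivAt (fun t : ℝ => (t : ℂ) * fderiv ℝ φ m h) (fderiv ℝ φ m h) t := by
      simpa using (Complex.ofRealCLM.hasDerivAt (x := t)).mul_const (fderiv ℝ φ m h)
    exact h2.sub h3
  have hbound : ∀ t ∈ Ico (-1 : ℝ) 1,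
      ‖fderiv ℝ φ (m + (t : ℂ) * h) h - fderiv ℝ φ m h‖ ≤ L * ‖h‖ ^ 2 := by
    intro t ht
    calc ‖fderiv ℝ φ (m + (t : ℂ) * h) h - fderiv ℝ φ m h‖
        = ‖(fderiv ℝ φ (m + (t : ℂ) * h) - fderiv ℝ φ m) h‖ := rfl
      _ ≤ ‖fderiv ℝ φ (m + (t : ℂ) * h) - fderiv ℝ φ m‖ * ‖h‖ := ContinuousLinearMap.le_opNorm _ _
      _ ≤ (L * dist (m + (t : ℂ) * h) m) * ‖h‖ := by
          gcongr; rw [← dist_eq_norm]; exact hL.dist_le_mul _ _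
      _ ≤ (L * ‖h‖) * ‖h‖ := by
          gcongr
          rw [dist_eq_norm, add_sub_cancel_left, norm_mul, Complex.norm_real, Real.norm_eq_abs]
          have : |t| ≤ 1 := abs_le.2 ⟨ht.1, ht.2.le⟩
          nlinarith [norm_nonneg h]
      _ = L * ‖h‖ ^ 2 := by ring
  have key := norm_image_sub_le_of_norm_deriv_le_segment' (a := -1) (b := 1)
    (fun t _ => (hGd t).hasDerivWithinAt) hbound 1 (by norm_num)
  have hG1 : G 1 - G (-1) = φ (m + h) - φ (m - h) - fderiv ℝ φ m ((2 : ℝ) • h) := by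
    simp only [hG]
    rw [map_smul, Complex.real_smul]; push_cast; ring
  rw [← hG1]
  calc ‖G 1 - G (-1)‖ ≤ L * ‖h‖ ^ 2 * (1 - -1) := key
    _ = 2 * L * ‖h‖ ^ 2 := by ring

/-! ### The cube identity for the three up-to-down vectors -/

/-- `a³ = (2ζ - 1)/9` (`= i/(3√3)`). [folklore] -/
theorem vecA_cube : vecA ^ 3 = (2 * triZeta - 1) / 9 := by
  have h := triZeta_sq
  simp only [vecA]
  linear_combination ((triZeta + 4) / 27 : ℂ) * h

/-- `b³ = a³`. [folklore] -/
theorem vecB_cube : vecB ^ 3 = vecA ^ 3 := by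
  have h := triZeta_sq
  simp only [vecB, vecA]
  linear_combination (-1 / 3 : ℂ) * h

/-- `c³ = a³`. [folklore] -/
theorem vecC_cube : vecC ^ 3 = vecA ^ 3 := by
  have h := triZeta_sq
  simp only [vecC, vecA]
  linear_combination (-triZeta / 3 : ℂ) * h

/-- From `u³ = a³` and `conj u · u = 1/3`: `u² = 3a³ · conj u`. [folklore] -/
theorem sq_eq_of_cube_eq {u : ℂ} (hcube : u ^ 3 = vecA ^ 3) (hnorm : conj u * u = 1 / 3) :
    u ^ 2 = 3 * vecA ^ 3 * conj u := by
  have hu : u ≠ 0 := by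
    intro h0; rw [h0, mul_zero] at hnorm; norm_num at hnorm
  have : u ^ 2 * u = 3 * vecA ^ 3 * conj u * u := by
    rw [mul_assoc, hnorm, ← hcube]; ring
  exact mul_right_cancel₀ hu this

/-- **The up-to-down vectors.** For an up face `v` (`v.2 = 0`) and a neighbour `w ∈ nbrs v`, the
centre-to-centre vector `u = c_w - c_v` is one of `a, b, c`; hence `conj u · u = 1/3` and
`u² = 3a³ · conj u`. [folklore] -/
theorem sq_eq_of_mem_nbrs_up {v w : HexVertex} (hv : v.2 = 0) (hw : w ∈ nbrs v) :
    conj (hexCenter w - hexCenter v) * (hexCenter w - hexCenter v) = 1 / 3 ∧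
      (hexCenter w - hexCenter v) ^ 2 = 3 * vecA ^ 3 * conj (hexCenter w - hexCenter v) := by
  obtain ⟨y, i⟩ := v
  simp only at hv
  subst hv
  obtain ⟨hA, hB, hC⟩ := hexCenter_sub_up y
  rw [nbrs_up] at hw
  simp only [Finset.mem_insert, Finset.mem_singleton] at hw
  rcases hw with rfl | rfl | rfl
  · rw [hA]; exact ⟨conj_vecA_mul_vecA, sq_eq_of_cube_eq rfl conj_vecA_mul_vecA⟩
  · rw [hB]; exact ⟨conj_vecB_mul_vecB, sq_eq_of_cube_eq vecB_cube conj_vecB_mul_vecB⟩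
  · rw [hC]; exact ⟨conj_vecC_mul_vecC, sq_eq_of_cube_eq vecC_cube conj_vecC_mul_vecC⟩

/-- The up-to-down vectors have norm `≤ 1` (indeed `1/√3`). [folklore] -/
theorem norm_sub_le_one_of_mem_nbrs_up {v w : HexVertex} (hv : v.2 = 0) (hw : w ∈ nbrs v) :
    ‖hexCenter w - hexCenter v‖ ≤ 1 := by
  have h := (sq_eq_of_mem_nbrs_up hv hw).1
  rw [Complex.conj_mul'] at h
  have hsq : ‖hexCenter w - hexCenter v‖ ^ 2 = 1 / 3 := by
    have h' : ((‖hexCenter w - hexCenter v‖ ^ 2 : ℝ) : ℂ) = ((1 / 3 : ℝ) : ℂ) := by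
      push_cast; exact_mod_cast h
    exact_mod_cast h'
  nlinarith [norm_nonneg (hexCenter w - hexCenter v)]

/-! ### The per-edge identity -/

/-- **The per-edge Taylor identity (registered sub-goal `pickEngine_edgeTaylor` of stub
`stub_pickEngine`).** For `φ ∈ C²(ℂ)` with compact support there is `C ≥ 0` such that for every
mesh `δ`, every up face `v`, every neighbour `w ∈ nbrs v` and every `F`, writing `u = c_w - c_v`
and `m = mid{v,w}`:
`(φ(δc_v) - φ(δc_w))·(m - c_v)F{v,w} = -(δ/2)·F{v,w}·(3a³·conj u·∂φ(δm) + (1/3)·∂̄φ(δm)) + E`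
with `‖E‖ ≤ C δ² ‖F{v,w}‖` (`∂φ = ½(φₓ - iφ_y)`, `∂̄φ = dbarAlong 1 φ`). [folklore] -/
theorem pickEngine_edgeTaylor :
    ∀ (φ : ℂ → ℂ), ContDiff ℝ 2 φ → HasCompactSupport φ → ∃ C : ℝ, 0 ≤ C ∧
      ∀ (δ : ℝ) (F : Sym2 HexVertex → ℂ) (v w : HexVertex), v.2 = 0 → w ∈ nbrs v →
        ‖(φ ((δ : ℂ) * hexCenter v) - φ ((δ : ℂ) * hexCenter w)) * term F v w +
            (δ : ℂ) / 2 * F s(v, w) *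
              (3 * vecA ^ 3 * conj (hexCenter w - hexCenter v) *
                  ((2 : ℂ)⁻¹ * (fderiv ℝ φ ((δ : ℂ) * hexMidpoint s(v, w)) 1 -
                    I * fderiv ℝ φ ((δ : ℂ) * hexMidpoint s(v, w)) I)) +
                (1 / 3 : ℂ) * dbarAlong 1 φ ((δ : ℂ) * hexMidpoint s(v, w)))‖ ≤
          C * δ ^ 2 * ‖F s(v, w)‖ := by
  intro φ hφ hφc
  obtain ⟨C, hC0, hC⟩ := norm_symm_diff_sub_fderiv_le hφ hφc
  refine ⟨C, hC0, fun δ F v w hv hw => ?_⟩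
  set u : ℂ := hexCenter w - hexCenter v with hu
  set m : ℂ := (δ : ℂ) * hexMidpoint s(v, w) with hm
  set h : ℂ := (δ : ℂ) * u / 2 with hh
  obtain ⟨hnorm, hsq⟩ := sq_eq_of_mem_nbrs_up hv hw
  -- positions: `δ c_w = m + h`, `δ c_v = m - h`, `m - c_v`-coefficient `u/2`
  have hmid : hexMidpoint s(v, w) = (hexCenter v + hexCenter w) / 2 := hexMidpoint_mk v w
  have hcw : (δ : ℂ) * hexCenter w = m + h := by rw [hm, hh, hmid, hu]; ring
  have hcv : (δ : ℂ) * hexCenter v = m - h := by rw [hm, hh, hmid, hu]; ring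
  have hterm : term F v w = u / 2 * F s(v, w) := by
    simp only [term, hmid, hu]; ring
  -- the Taylor remainder
  set R : ℂ := φ (m + h) - φ (m - h) - fderiv ℝ φ m ((2 : ℝ) • h) with hR
  have hRle : ‖R‖ ≤ C * ‖h‖ ^ 2 := hC m h
  have hD : fderiv ℝ φ m ((2 : ℝ) • h) = (δ : ℂ) * ((2 : ℂ)⁻¹ * (fderiv ℝ φ m 1 - I * fderiv ℝ φ m I) * u +
      dbarAlong 1 φ m * conj u) := by
    have h2h : (2 : ℝ) • h = (δ : ℝ) • u := by
      rw [hh, Complex.real_smul, Complex.real_smul]; push_cast; ring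
    rw [h2h, (fderiv ℝ φ m).map_smul, Complex.real_smul, fderiv_apply_eq_wirtinger]
  -- the identity with error `-(u/2) F R`
  have hid : (φ ((δ : ℂ) * hexCenter v) - φ ((δ : ℂ) * hexCenter w)) * term F v w +
      (δ : ℂ) / 2 * F s(v, w) * (3 * vecA ^ 3 * conj u *
        ((2 : ℂ)⁻¹ * (fderiv ℝ φ m 1 - I * fderiv ℝ φ m I)) + (1 / 3 : ℂ) * dbarAlong 1 φ m) =
      -(u / 2 * F s(v, w) * R) := by
    rw [hcv, hcw, hterm]
    have hφdiff : φ (m - h) - φ (m + h) = -(fderiv ℝ φ m ((2 : ℝ) • h) + R) := by rw [hR]; ring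
    rw [hφdiff, hD]
    have e1 : u * u = 3 * vecA ^ 3 * conj u := by rw [← sq, hsq]
    have e2 : u * conj u = 1 / 3 := by rw [mul_comm, hnorm]
    linear_combination (-(δ : ℂ) / 2 * F s(v, w) * ((2 : ℂ)⁻¹ * (fderiv ℝ φ m 1 -
      I * fderiv ℝ φ m I))) * e1 + (-(δ : ℂ) / 2 * F s(v, w) * dbarAlong 1 φ m) * e2
  rw [hid, norm_neg, norm_mul, norm_mul, norm_div, Complex.norm_two]
  have hule : ‖u‖ ≤ 1 := norm_sub_le_one_of_mem_nbrs_up hv hw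
  have hh_le : ‖h‖ ≤ |δ| / 2 := by
    rw [hh, norm_div, Complex.norm_two, norm_mul, Complex.norm_real, Real.norm_eq_abs]
    have := mul_le_mul_of_nonneg_left hule (abs_nonneg δ)
    linarith
  have hh_sq : ‖h‖ ^ 2 ≤ δ ^ 2 / 4 := by
    have h0 : 0 ≤ ‖h‖ := norm_nonneg _
    have : ‖h‖ ^ 2 ≤ (|δ| / 2) ^ 2 := pow_le_pow_left₀ h0 hh_le 2
    rw [div_pow, sq_abs] at this
    linarith
  calc ‖u‖ / 2 * ‖F s(v, w)‖ * ‖R‖ ≤ 1 / 2 * ‖F s(v, w)‖ * (C * (δ ^ 2 / 4)) := by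
        gcongr
        exact hRle.trans (mul_le_mul_of_nonneg_left hh_sq hC0)
    _ = C / 8 * δ ^ 2 * ‖F s(v, w)‖ := by ring
    _ ≤ C * δ ^ 2 * ‖F s(v, w)‖ := by
        have : 0 ≤ δ ^ 2 * ‖F s(v, w)‖ := by positivity
        nlinarith

end Summit.CriticalPhenomena.SAWScalingLimit.Theorems.PickHalfPlane.Engine

end
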